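import Summits.ResolutionOfSingularities.ResolutionOfSingularities.Theorems.PurelyInseparableDim4ResConeTwoSlotFlag
import Summits.ResolutionOfSingularities.ResolutionOfSingularities.Theorems.PurelyInseparableDim4TschirnhausChain
import Summits.ResolutionOfSingularities.ResolutionOfSingularities.Theorems.PurelyInseparableDim4ResConeLedgerPersist
import HarnessLib
import HarnessLib.Audit.Tags

/-!
# Purely inseparable four-folds — TWO-SLOT GAME, THE FRAMED SLOT STEP: read in a Tschirnhaus jet frame a slot step
# is a pure corner step of the framed state, and it costs one order of Tschirnhaus (cell `res-dim4-pi`, K2(p) lane,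
# slice B brick K24a, part β4-S, file 1 of 2)

[OURS · counted 0 · cell `res-dim4-pi` · K2(p) lane (holder res-dim4-p-12 g3, «p-1 takes K24a» 2026-08-29
01:14Z; statement layer 01:24Z, stub β4-S); seat res-dim4-p-1 g4 over res-dim4-p-11 g2's E1 `step_F_cleanTsch` /
`step_r_cleanTsch` (`…TschirnhausClean`) and res-dim4-p-1 g3's β5 chart law (`…ResConeTwoSlotLegality`).]  Nothing
here proves K2(p)/K2(5), `NoIsolatedTrap p p` or resolution of singularities in dimension ≥ 4 / characteristic `p`.
AI kernel work, weaker than expert review.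

THE GLUE, PART 1 (`p = 5`, `d = 3`, two-slot regime, slot step in chart `κ`; letters `κ, o` = slots, `ν` idle,
`f` free).  The REAL step is `s ↦ s′ = step 5 univ κ (β·e_f) s` — translation along the contact letter only, `β`
dictated by the direction equation.  Read in a frame `φ` at `f` with `φ(0) = 0` and linear coefficient
`coeff_{x_κ} φ = β`, the framed step is the PURE CORNER step of the framed state `S̃ = clean (τ_φ s)`, and its child is
the re-framing of `s′` by the transported datum `φ⁺` (E1 read at the origin).

* §1 tools: `coeff_step_zero_boundary` (β5's chart law made public: `x^{r+m} ↦ x^{r + m.update κ (|m|−3)}`),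
  `coeff_clean_tsch_boundary_add` (reading a cleaned framed state on the framed residual),
  `homogeneousComponent_eq_C_mul_X_pow_of_coeff`, and two «not a 5-th power» exponent checks.
* §2 **`step_zero_framed_F` / `step_zero_framed_r`** — the framed slot step is a pure corner:
  `(step 5 univ κ 0 S̃).F = clean (τ_{φ⁺} s′.F)`, `(step 5 univ κ 0 S̃).r = s′.r`.
* §3 **`tsch_order_step_zero`** — a pure corner step keeps a Tschirnhaus frame of order `N` Tschirnhaus to order
  `N − 1` (a child `x_f²`-monomial of residual degree `D` has a parent `x_f²`-monomial of residual degree `≤ D + 1`).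

Part 2 (`…ResConeTwoSlotTransport`): the one-step package `slot_step_readings` (β5 + β6 + chart law + D4).
[cite: CossartJannsenSaito2020, Thm. 3.14] [cite: HauserPerlega2019PRIMS, §2 (the blowup in the x₁-chart)]
bears_on: LADDER-RESOLUTION:D157-DOOR2 (res-dim4-pi · K2(p) · slice B · K24a-β4-S).  Supports
stmt-ResolutionOfSingularities-16155 (helper).
-/

set_option linter.dupNamespace false -- mandated namespace of this single-conjunct summit

noncomputable section

namespace Summit.ResolutionOfSingularities.ResolutionOfSingularities.Theorems.PIDim4

namespace ResCone

open MvPolynomial Finset FrameChange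
open Literature.AlgebraicGeometry.Resolution
open Literature.AlgebraicGeometry.Resolution.CentreBlowup
open Literature.AlgebraicGeometry.Resolution.Hauser2010
open Literature.AlgebraicGeometry.Resolution.HauserPerlega2019
open PointBlowup (translate)

variable {K : Type} [Field K]

/-! ## 1. Tools -/

section Tools

variable [DecidableEq K]

/-- **THE CHART LAW AT FRAME MONOMIALS** (β5's `hchart`, public): boundary `r = e_κ + e_o + e_ν`, `ord ≥ 5`; for
`|m| ≥ 3` with `m_ν ≤ 3` the coefficient of `x^{r+m}` is carried to the chart image `x^{r + m.update κ (|m| − 3)}`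
(no deletion: the image's `ν`-exponent is `1 + m_ν ∈ [1, 4]`). [folklore]
[cite: HauserPerlega2019PRIMS, §2 (the blowup in the x₁-chart)] -/
theorem coeff_step_zero_boundary {κ o ν : Fin 4} (hκo : κ ≠ o) (hκν : κ ≠ ν) (hoν : o ≠ ν) {s : State K}
    (hr : s.r = Finsupp.single κ 1 + Finsupp.single o 1 + Finsupp.single ν 1)
    (hq : ((5 : ℕ) : ℕ∞) ≤ ordAlong Finset.univ s.F) {m : Fin 4 →₀ ℕ} (hm : 3 ≤ m.degree) (hmν : m ν ≤ 3) :
    coeff (s.r + m.update κ (m.degree - 3)) (CentreBlowup.step 5 Finset.univ κ 0 s).F = coeff (s.r + m) s.F := by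
  have hrν : s.r ν = 1 := by rw [hr]; simp [hκν, hoν]
  have hrdeg : s.r.degree = 3 := by rw [hr, map_add, map_add]; simp
  rw [← chartExponent_boundary_add hκo hκν hr hm, coeff_step_zero_chartExponent 5 κ s hq
    (by rw [map_add, hrdeg]; omega), if_neg (not_isPthPowerExponent_of_not_dvd (i := ν) ?_)]
  rw [chartExponent_boundary_add hκo hκν hr hm, Finsupp.add_apply, hrν, Finsupp.coe_update,
    Function.update_of_ne hκν.symm]
  omega

omit [DecidableEq K] in
/-- **Reading a cleaned framed state on the framed residual**: `F = x^r·G`, `r_f = 0`; at an exponent `r + m` that is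
not a `q`-th power, `coeff_{r+m} (clean_q (τ_φ F)) = coeff_m (τ_φ G)`. [folklore] -/
theorem coeff_clean_tsch_boundary_add (q : ℕ) {f : Fin 4} (φ : MvPolynomial (Fin 4) K)
    {F G : MvPolynomial (Fin 4) K} {r m : Fin 4 →₀ ℕ} (hrf : r f = 0) (hF : F = monomial r 1 * G)
    (hnp : ¬ IsPthPowerExponent q (r + m)) :
    coeff (r + m) (deletePthPowers q (tsch f φ F)) = coeff m (tsch f φ G) := by
  classical
  rw [coeff_deletePthPowers, if_neg hnp, hF, tsch_monomial_mul φ hrf, coeff_monomial_mul', if_pos le_self_add,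
    add_tsub_cancel_left, one_mul]

omit [DecidableEq K] in
/-- A polynomial whose degree-`d` coefficients vanish off `x_f^d` has degree-`d` part `c·x_f^d`. [folklore] -/
theorem homogeneousComponent_eq_C_mul_X_pow_of_coeff {P : MvPolynomial (Fin 4) K} {f : Fin 4} {d : ℕ}
    (h : ∀ m : Fin 4 →₀ ℕ, m.degree = d → m ≠ Finsupp.single f d → coeff m P = 0) :
    homogeneousComponent d P = C (coeff (Finsupp.single f d) P) * X f ^ d := by
  classical
  ext m
  rw [coeff_homogeneousComponent, X_pow_eq_monomial, C_mul_monomial, mul_one, coeff_monomial]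
  by_cases hm : m.degree = d
  · rw [if_pos hm]
    by_cases hmf : Finsupp.single f d = m
    · rw [if_pos hmf, hmf]
    · rw [if_neg hmf, h m hm (Ne.symm hmf)]
  · rw [if_neg hm, if_neg]
    rintro rfl
    exact hm (Finsupp.degree_single f d)

omit [DecidableEq K] in
/-- `r + m` (`r = e_κ + e_o + e_ν`) is not a `5`-th-power exponent when `m_ν ≤ 3`. [folklore] -/
theorem not_isPthPowerExponent_boundary_add {κ o ν : Fin 4} (hκν : κ ≠ ν) (hoν : o ≠ ν) {r m : Fin 4 →₀ ℕ}
    (hr : r = Finsupp.single κ 1 + Finsupp.single o 1 + Finsupp.single ν 1) (hmν : m ν ≤ 3) :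
    ¬ IsPthPowerExponent 5 (r + m) := by
  refine not_isPthPowerExponent_of_not_dvd (i := ν) ?_
  have hrν : r ν = 1 := by rw [hr]; simp [hκν, hoν]
  rw [Finsupp.add_apply, hrν]
  omega

omit [DecidableEq K] in
/-- `r + m` is not a `5`-th-power exponent when `1 ≤ m_f ≤ 4` and `r_f = 0`. [folklore] -/
theorem not_isPthPowerExponent_boundary_add_of_apply {f : Fin 4} {r m : Fin 4 →₀ ℕ} (hrf : r f = 0)
    (h1 : 1 ≤ m f) (h4 : m f ≤ 4) : ¬ IsPthPowerExponent 5 (r + m) := by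
  refine not_isPthPowerExponent_of_not_dvd (i := f) ?_
  rw [Finsupp.add_apply, hrf]
  omega

end Tools

/-! ## 2. The framed slot step is a pure corner -/

section Framed

variable [CharP K 5] [DecidableEq K]

/-- **THE FRAMED SLOT STEP, `F`-component** (E1 read at the origin): for a frame `φ` at `f ≠ κ` with `φ(0) = 0` and
`coeff_{x_κ} φ = β`, the pure corner child of the framed state `clean (τ_φ s)` in chart `κ` has
`F`-component `clean (τ_{φ⁺} (step 5 univ κ (β·e_f) s).F)`, `φ⁺` the transported datum. [OURS]
[cite: Hauser2010, §§F–G (blowup followed by cleaning)] -/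
theorem step_zero_framed_F {κ f : Fin 4} (hκf : κ ≠ f) {s : State K} (hq : ((5 : ℕ) : ℕ∞) ≤ ordZero s.F)
    {φ : MvPolynomial (Fin 4) K} (h0 : constantCoeff φ = 0) {β : K} (hφκ : coeff (Finsupp.single κ 1) φ = β) :
    (CentreBlowup.step 5 Finset.univ κ 0 (⟨deletePthPowers 5 (tsch f φ s.F), s.r, s.exc⟩ : State K)).F =
      deletePthPowers 5 (tsch f (translate (0 : Fin 4 → K) (chartTransform 1 Finset.univ κ φ) -
        C (MvPolynomial.eval (0 : Fin 4 → K) (chartTransform 1 Finset.univ κ φ)))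
        (CentreBlowup.step 5 Finset.univ κ (Pi.single f β) s).F) := by
  haveI : Fact (Nat.Prime 5) := ⟨by norm_num⟩
  have hev : MvPolynomial.eval (0 : Fin 4 → K) (chartTransform 1 Finset.univ κ φ) = β := by
    rw [MvPolynomial.eval_zero, constantCoeff_chartTransform_one κ (fun e he => ?_), hφκ]
    rw [Nat.one_le_iff_ne_zero]
    intro hdeg
    rw [Finsupp.degree_eq_zero_iff] at hdeg
    subst hdeg
    exact (MvPolynomial.mem_support_iff.mp he) (by rwa [← constantCoeff_eq])
  have hb : Function.update (0 : Fin 4 → K) f ((0 : Fin 4 → K) f +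
      MvPolynomial.eval (0 : Fin 4 → K) (chartTransform 1 Finset.univ κ φ)) = Pi.single f β := by
    rw [update_eq_single_add, add_zero, hev]
  rw [step_F_cleanTsch (p := 5) hq hκf h0 (0 : Fin 4 → K), hb]

/-- **THE FRAMED SLOT STEP, `r`-component**: same hypotheses (and `f ∉ φ.vars`, `r_f = 0`, `s.F` clean); the
boundary of the framed pure corner child is that of the real child `step 5 univ κ (β·e_f) s`. [OURS]
[cite: HauserPerlega2019PRIMS, §2 (transform D' of D)] -/
theorem step_zero_framed_r {κ f : Fin 4} {s : State K} (hs : deletePthPowers 5 s.F = s.F)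
    {φ : MvPolynomial (Fin 4) K} (hφ : f ∉ φ.vars) (h0 : constantCoeff φ = 0) (hrf : s.r f = 0) {β : K}
    (hφκ : coeff (Finsupp.single κ 1) φ = β) :
    (CentreBlowup.step 5 Finset.univ κ 0 (⟨deletePthPowers 5 (tsch f φ s.F), s.r, s.exc⟩ : State K)).r =
      (CentreBlowup.step 5 Finset.univ κ (Pi.single f β) s).r := by
  haveI : Fact (Nat.Prime 5) := ⟨by norm_num⟩
  have hev : MvPolynomial.eval (0 : Fin 4 → K) (chartTransform 1 Finset.univ κ φ) = β := by
    rw [MvPolynomial.eval_zero, constantCoeff_chartTransform_one κ (fun e he => ?_), hφκ]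
    rw [Nat.one_le_iff_ne_zero]
    intro hdeg
    rw [Finsupp.degree_eq_zero_iff] at hdeg
    subst hdeg
    exact (MvPolynomial.mem_support_iff.mp he) (by rwa [← constantCoeff_eq])
  have hb : Function.update (0 : Fin 4 → K) f ((0 : Fin 4 → K) f +
      MvPolynomial.eval (0 : Fin 4 → K) (chartTransform 1 Finset.univ κ φ)) = Pi.single f β := by
    rw [update_eq_single_add, add_zero, hev]
  rw [step_r_cleanTsch (p := 5) hs hφ h0 hrf κ (0 : Fin 4 → K), hb]

end Framed

/-! ## 3. A pure corner step costs one order of Tschirnhaus -/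

section Order

variable [DecidableEq K]

/-- **A PURE CORNER STEP KEEPS A TSCHIRNHAUS FRAME OF ORDER `N` TSCHIRNHAUS TO ORDER `N − 1`**: boundary
`r = e_κ + e_o + e_ν`, `x^r ∣ F̃`, `ord₀ F̃ = 6`, free letter `f ∉ {κ, o, ν}`; if `F̃` has no monomial `x^{r+m}` with
`m_f = 2`, `|m| ≤ N + 2`, then the pure corner child in chart `κ` has none with `m_f = 2`, `|m| ≤ N + 1` (a child
residual monomial `x^{n}` is the image `m.update κ (|m| − 3)` of a parent residual monomial, `n_f = m_f`, and
`|n| = 2|m| − 3 − m_κ ≥ |m| − 1`). [folklore] [cite: HauserPerlega2019PRIMS, §2 (the blowup in the x₁-chart)] -/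
theorem tsch_order_step_zero {κ o ν f : Fin 4} (hκo : κ ≠ o) (hκν : κ ≠ ν) (hκf : κ ≠ f) (hoν : o ≠ ν)
    (hof : o ≠ f) (hνf : ν ≠ f) {S : State K}
    (hr : S.r = Finsupp.single κ 1 + Finsupp.single o 1 + Finsupp.single ν 1)
    (hdiv : ∀ e ∈ S.F.support, S.r ≤ e) (ho : ordZero S.F = (6 : ℕ)) {N : ℕ}
    (hN : ∀ m : Fin 4 →₀ ℕ, m f = 2 → m.degree ≤ N + 2 → coeff (S.r + m) S.F = 0)
    {n : Fin 4 →₀ ℕ} (hnf : n f = 2) (hn : n.degree ≤ N + 1) :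
    coeff (S.r + n) (CentreBlowup.step 5 Finset.univ κ 0 S).F = 0 := by
  classical
  by_contra hne
  have hrdeg : S.r.degree = 3 := by rw [hr, map_add, map_add]; simp
  obtain ⟨e, he, heE⟩ := exists_of_mem_support_step_zero κ S (MvPolynomial.mem_support_iff.mpr hne)
  obtain ⟨m, rfl⟩ : ∃ m, e = S.r + m := ⟨e - S.r, (add_tsub_cancel_of_le (hdiv e he)).symm⟩
  have h6 := le_degree_of_mem_support_of_ordZero ho he
  rw [map_add, hrdeg] at h6
  have h3m : 3 ≤ m.degree := by omega
  rw [chartExponent_boundary_add hκo hκν hr h3m] at heE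
  have hnm : n = m.update κ (m.degree - 3) := (add_left_cancel heE).symm
  -- `m_f = n_f = 2`
  have hmf : m f = 2 := by
    have h := DFunLike.congr_fun hnm f
    rw [Finsupp.coe_update, Function.update_of_ne hκf.symm] at h
    rw [← h]; exact hnf
  -- the parent monomial lies beyond the Tschirnhaus range
  have hbig : N + 3 ≤ m.degree := by
    by_contra hlt
    exact (MvPolynomial.mem_support_iff.mp he) (hN m hmf (by omega))
  -- degree count of the image
  have hm4 := eq_sum_single_four hκo hκν hκf hoν hof hνf m
  obtain ⟨hqκ, hqo, hqν, hqf⟩ := quad_apply hκo hκν hκf hoν hof hνf (m κ) (m o) (m ν) (m f)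
  have hmdeg : m.degree = m κ + m o + m ν + m f := by
    conv_lhs => rw [hm4]
    exact degree_quad κ o ν f _ _ _ _
  have hn4 : n = Finsupp.single κ (m.degree - 3) + Finsupp.single o (m o) + Finsupp.single ν (m ν) +
      Finsupp.single f (m f) := by
    rw [hnm]
    ext k
    rcases letters_exhaust hκo hκν hκf hoν hof hνf k with rfl | rfl | rfl | rfl
    · simp [hκo.symm, hκν.symm, hκf.symm]
    · simp [Finsupp.coe_update, Function.update_of_ne hκo.symm, hκo, hoν.symm, hof.symm]
    · simp [Finsupp.coe_update, Function.update_of_ne hκν.symm, hκν, hoν, hνf.symm]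
    · simp [Finsupp.coe_update, Function.update_of_ne hκf.symm, hκf, hof, hνf]
  have hndeg : n.degree = (m.degree - 3) + m o + m ν + m f := by
    rw [hn4]; exact degree_quad κ o ν f _ _ _ _
  omega

end Order

end ResCone

end Summit.ResolutionOfSingularities.ResolutionOfSingularities.Theorems.PIDim4

end
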